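import Summits.QuantumFields.YangMills.Theorems.ConvexGribovBodyCovarianceBoundDefs

/-!
# Stub `stub_modeReduction` of the line `Sketch` for the crux `CovarianceBound`
# (stmt-QuantumFields-8780, route `ConvexGribovBody`)

Mode reduction for the minimal-Coulomb-gauge gluon covariance integrand — pure algebra and
bookkeeping over the vocabulary of `ConvexGribovBodyCovarianceBoundDefs`:

* the crux Fourier mode factors through the mid-link cosine/sine modes,
  `Â_j(p) = e^{iπp_j/L} (Ĉ_j(p) - i Ŝ_j(p))`, and `‖Â_j‖²_F = ‖Ĉ_j‖²_F + ‖Ŝ_j‖²_F` because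
  `Ĉ_j, Ŝ_j` are anti-Hermitian (the cross term `Σ_{ab} (Re Ĉ_{ab} Im Ŝ_{ab} - Im Ĉ_{ab} Re Ŝ_{ab})`
  is antisymmetric in `(a,b)`); hence `cov = L⁻³ Σ_j (‖Ĉ_j‖² + ‖Ŝ_j‖²)` pointwise,
  `sup_h cov ≤ L⁻³ Σ_j (sup_h ‖Ĉ_j‖² + sup_h ‖Ŝ_j‖²)`, and the integrated inequality (A);
* `Ŝ_j(0) = 0` (every phase is `sin 0`), so its sup vanishes (B);
* for a measurable minimiser selection attaining `sup_h ‖Ĉ_j‖²` the integral splits into the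
  `2N²` real components, each measurable (continuity of `ρ`, measurability of the group
  operations of the second-countable `G`) and dominated by `L³ · cov` (C).
-/

set_option autoImplicit false

noncomputable section

namespace Summit.QuantumFields.YangMills.Cruxes.CovarianceBound.SupportWindow

open scoped BigOperators Matrix ComplexConjugate
open MeasureTheory
open Literature.MathematicalPhysics.QuantumFieldTheory

variable {G : Type} [Group G] [TopologicalSpace G]

namespace ModeReduction

/-! ### Algebra: anti-Hermitian modes and the Frobenius identity -/

/-- `0 ≤ ‖M‖²_F`. [folklore] -/
theorem froSq_nonneg {N : ℕ} (M : Matrix (Fin N) (Fin N) ℂ) : 0 ≤ froSq M :=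
  Finset.sum_nonneg fun _ _ => Finset.sum_nonneg fun _ _ => by positivity

/-- `‖C - iT‖²_F = ‖C‖²_F + ‖T‖²_F` for anti-Hermitian `C, T`: the cross term
`2 Σ_{ab} (Re C_{ab} Im T_{ab} - Im C_{ab} Re T_{ab})` is antisymmetric under `a ↔ b`. [folklore] -/
theorem froSq_sub_I_smul {N : ℕ} (C T : Matrix (Fin N) (Fin N) ℂ) (hC : Cᴴ = -C)
    (hT : Tᴴ = -T) : froSq (C - Complex.I • T) = froSq C + froSq T := by
  have e : ∀ M : Matrix (Fin N) (Fin N) ℂ, Mᴴ = -M → ∀ a b,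
      (M a b).re = -(M b a).re ∧ (M a b).im = (M b a).im := fun M hM a b => by
    have h := congr_fun (congr_fun hM a) b
    simp only [Matrix.conjTranspose_apply, Matrix.neg_apply] at h
    rw [neg_eq_iff_eq_neg.mp h.symm]
    simp
  set x : Fin N → Fin N → ℝ := fun a b => (C a b).re * (T a b).im - (C a b).im * (T a b).re
    with hx
  have hanti : ∀ a b, x a b = -x b a := fun a b => by
    obtain ⟨h1, h2⟩ := e C hC a b
    obtain ⟨h3, h4⟩ := e T hT a b
    simp only [hx, h1, h2, h3, h4]
    ring
  have hsum : ∑ a, ∑ b, x a b = 0 := by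
    have h1 : ∑ a, ∑ b, x a b = -∑ a, ∑ b, x a b :=
      calc ∑ a, ∑ b, x a b = ∑ a, ∑ b, -x b a :=
            Finset.sum_congr rfl fun a _ => Finset.sum_congr rfl fun b _ => hanti a b
        _ = -∑ a, ∑ b, x b a := by simp only [Finset.sum_neg_distrib]
        _ = -∑ a, ∑ b, x a b := by rw [Finset.sum_comm]
    linarith
  have key : ∀ a b,
      ‖(C - Complex.I • T) a b‖ ^ 2 = ‖C a b‖ ^ 2 + ‖T a b‖ ^ 2 + 2 * x a b := fun a b => by
    simp only [hx, Matrix.sub_apply, Matrix.smul_apply, smul_eq_mul, Complex.sq_norm,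
      Complex.normSq_apply, Complex.sub_re, Complex.sub_im, Complex.mul_re, Complex.mul_im,
      Complex.I_re, Complex.I_im]
    ring
  simp only [froSq, key, Finset.sum_add_distrib, ← Finset.mul_sum, hsum, mul_zero, add_zero]

variable (r : LatticeRep G) (S : ℕ) (p : Fin 3 → ZMod (2 * S + 1)) (j : Fin 3)
  (U : GaugeConfig 4 (2 * S + 1) G) (h : Site 4 (2 * S + 1) → G)

/-- The gluon field is anti-Hermitian: `A_j(y)ᴴ = -A_j(y)`. [folklore] -/
theorem gluon_conjTranspose (y : Fin 3 → ZMod (2 * S + 1)) :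
    (gluon r S U h y j)ᴴ = -gluon r S U h y j := by
  ext a b
  simp [gluon, Matrix.conjTranspose_apply]
  ring

/-- Real linear combinations of the gluon field are anti-Hermitian. [folklore] -/
theorem conjTranspose_sum_smul_gluon (c : (Fin 3 → ZMod (2 * S + 1)) → ℝ) :
    (∑ y, ((c y : ℝ) : ℂ) • gluon r S U h y j)ᴴ = -∑ y, ((c y : ℝ) : ℂ) • gluon r S U h y j := by
  rw [Matrix.conjTranspose_sum, ← Finset.sum_neg_distrib]
  refine Finset.sum_congr rfl fun y _ => ?_
  rw [Matrix.conjTranspose_smul, gluon_conjTranspose, Complex.star_def, Complex.conj_ofReal,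
    smul_neg]

/-- `Ĉ_j(p)` is anti-Hermitian. [folklore] -/
theorem cosMode_conjTranspose : (cosMode r S p j U h)ᴴ = -cosMode r S p j U h :=
  conjTranspose_sum_smul_gluon r S j U h _

/-- `Ŝ_j(p)` is anti-Hermitian. [folklore] -/
theorem sinMode_conjTranspose : (sinMode r S p j U h)ᴴ = -sinMode r S p j U h :=
  conjTranspose_sum_smul_gluon r S j U h _

/-- Phase factorisation `Â_j(p) = e^{iπ p_j/L} (Ĉ_j(p) - i Ŝ_j(p))`: with `θ_y = 2πp·y/L` and
`φ = πp_j/L`, `e^{-iθ_y} = e^{iφ} e^{-i(θ_y + φ)}` and `θ_y + φ` is the mid-link phase. [folklore] -/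
theorem sum_phase_smul_gluon :
    ∑ y : Fin 3 → ZMod (2 * S + 1), Complex.exp (-(2 * Real.pi * Complex.I *
        (∑ i : Fin 3, ((p i).val : ℂ) * ((y i).val : ℂ)) / (2 * S + 1 : ℂ))) • gluon r S U h y j =
      Complex.exp ((Real.pi * (p j).val / (2 * S + 1) : ℝ) * Complex.I) •
        (cosMode r S p j U h - Complex.I • sinMode r S p j U h) := by
  have hcs : ∀ x : ℝ, ((Real.cos x : ℝ) : ℂ) - Complex.I * ((Real.sin x : ℝ) : ℂ) =
      Complex.exp (-(x : ℂ) * Complex.I) := fun x => by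
    rw [Complex.exp_mul_I, Complex.cos_neg, Complex.sin_neg, Complex.ofReal_cos,
      Complex.ofReal_sin]
    ring
  unfold cosMode sinMode
  simp only [smul_sub, Finset.smul_sum, smul_smul]
  rw [← Finset.sum_sub_distrib]
  refine Finset.sum_congr rfl fun y _ => ?_
  rw [← sub_smul, ← mul_sub, hcs, ← Complex.exp_add]
  congr 2
  push_cast
  ring

/-- **Key identity** `‖Â_j(p)‖²_F = ‖Ĉ_j(p)‖²_F + ‖Ŝ_j(p)‖²_F`. [folklore] -/
theorem froSq_sum_phase_smul_gluon :
    froSq (∑ y : Fin 3 → ZMod (2 * S + 1), Complex.exp (-(2 * Real.pi * Complex.I *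
        (∑ i : Fin 3, ((p i).val : ℂ) * ((y i).val : ℂ)) / (2 * S + 1 : ℂ))) • gluon r S U h y j) =
      froSq (cosMode r S p j U h) + froSq (sinMode r S p j U h) := by
  rw [sum_phase_smul_gluon, ← froSq_sub_I_smul _ _ (cosMode_conjTranspose r S p j U h)
    (sinMode_conjTranspose r S p j U h)]
  unfold froSq
  simp only [Matrix.smul_apply, smul_eq_mul, norm_mul, Complex.norm_exp_ofReal_mul_I, one_mul]

/-- `cov(U,h,p) = L⁻³ Σ_j (‖Ĉ_j(p)‖²_F + ‖Ŝ_j(p)‖²_F)` (`modeCov` inlines `Â_j(p)` with `gluon`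
unfolded, whence the closing `rfl`). [folklore] -/
theorem modeCov_eq_cos_sin :
    modeCov r S U h p = (∑ j, (froSq (cosMode r S p j U h) + froSq (sinMode r S p j U h))) /
      (2 * S + 1 : ℝ) ^ 3 := by
  simp only [← froSq_sum_phase_smul_gluon]
  rfl

/-- `Ŝ_j(0) = 0`: every phase is `sin 0`. [folklore] -/
theorem sinMode_zero : sinMode r S 0 j U h = 0 := by
  unfold sinMode
  simp

end ModeReduction

open ModeReduction in
/-- **Stub 4 — mode reduction** for the line `Sketch` of the crux `CovarianceBound`:
(A) `∫ sup_h cov ≤ L⁻³ Σ_j (∫ sup_h ‖Ĉ_j‖² + ∫ sup_h ‖Ŝ_j‖²)` (from the pointwise identity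
`cov = L⁻³ Σ_j (‖Ĉ_j‖² + ‖Ŝ_j‖²)`, i.e. `‖Â_j‖² = ‖Ĉ_j‖² + ‖Ŝ_j‖²` for the anti-Hermitian mid-link
modes, `sup (f + g) ≤ sup f + sup g` over the nonempty minimiser subtype, and integrability of the
bounded measurable sups on the Wilson probability measure); (B) `sup_h ‖Ŝ_j(0)‖² = 0`; (C) for a
measurable minimiser selection attaining `sup_h ‖Ĉ_j‖²`: the integral is the sum of the `2N²`
component second moments, each component `Re/Im (Ĉ_j)_{ab}` is measurable, and
`(Re/Im (Ĉ_j)_{ab})² ≤ ‖Ĉ_j‖²_F ≤ ‖Â_j‖²_F ≤ Σ_j ‖Â_j‖²_F = L³ · cov`. [folklore] -/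
theorem stub_modeReduction :
    ∀ (G : Type) [Group G] [TopologicalSpace G] [IsTopologicalGroup G] [CompactSpace G]
    [MeasurableSpace G] [BorelSpace G] (r : LatticeRep G) (β : ℝ) (S : ℕ)
    (p : Fin 3 → ZMod (2 * S + 1)),
    (∀ U : GaugeConfig 4 (2 * S + 1) G, ∃ h, IsCoulMin r S U h) →
    (∀ (j : Fin 3) (U : GaugeConfig 4 (2 * S + 1) G) (h : Site 4 (2 * S + 1) → G),
      (0 ≤ modeCov r S U h p ∧ modeCov r S U h p ≤ 3 * r.N * (2 * S + 1 : ℝ) ^ 3) ∧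
      froSq (cosMode r S p j U h) ≤ r.N * (2 * S + 1 : ℝ) ^ 6 ∧
      froSq (sinMode r S p j U h) ≤ r.N * (2 * S + 1 : ℝ) ^ 6) →
    Measurable (supCov r S p) → (∀ j, Measurable (supCosSq r S p j)) →
    (∀ j, Measurable (supSinSq r S p j)) →
    (∫ U, supCov r S p U ∂(wilson4 r β S) ≤
      (1 / (2 * S + 1 : ℝ) ^ 3) * ∑ j : Fin 3,
        ((∫ U, supCosSq r S p j U ∂(wilson4 r β S)) +
          ∫ U, supSinSq r S p j U ∂(wilson4 r β S))) ∧
    (p = 0 → ∀ (j : Fin 3) (U : GaugeConfig 4 (2 * S + 1) G), supSinSq r S p j U = 0) ∧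
    (∀ (j : Fin 3) (sel : GaugeConfig 4 (2 * S + 1) G → (Site 4 (2 * S + 1) → G)),
      Measurable sel → (∀ U, IsCoulMin r S U (sel U)) →
      (∀ U, froSq (cosMode r S p j U (sel U)) = supCosSq r S p j U) →
      (∫ U, supCosSq r S p j U ∂(wilson4 r β S) =
        ∑ a : Fin r.N, ∑ b : Fin r.N, ∑ q : Bool,
          ∫ U, (cosComp r S p j a b q sel U) ^ 2 ∂(wilson4 r β S)) ∧
      (∀ (a b : Fin r.N) (q : Bool), Measurable (cosComp r S p j a b q sel)) ∧
      (∀ (a b : Fin r.N) (q : Bool) (U : GaugeConfig 4 (2 * S + 1) G),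
        (cosComp r S p j a b q sel U) ^ 2 ≤ (2 * S + 1 : ℝ) ^ 3 * modeCov r S U (sel U) p)) := by
  intro G _ _ _ _ _ _ r β S p hex hb hmcov hmcos hmsin
  have hne : ∀ U : GaugeConfig 4 (2 * S + 1) G,
      Nonempty {h : Site 4 (2 * S + 1) → G // IsCoulMin r S U h} := fun U =>
    let ⟨h, hh⟩ := hex U; ⟨⟨h, hh⟩⟩
  have hL : (0 : ℝ) < (2 * S + 1 : ℝ) ^ 3 := by positivity
  -- bounded measurable functions are integrable for the Wilson probability measure
  have hInt : ∀ {f : GaugeConfig 4 (2 * S + 1) G → ℝ} (C : ℝ), Measurable f → (∀ U, 0 ≤ f U) →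
      (∀ U, f U ≤ C) → Integrable f (wilson4 r β S) := fun C hm h0 hC =>
    Integrable.of_mem_Icc 0 C hm.aemeasurable (ae_of_all _ fun U => ⟨h0 U, hC U⟩)
  have iCov : Integrable (supCov r S p) (wilson4 r β S) :=
    hInt _ hmcov (fun U => Real.iSup_nonneg fun h => (hb 0 U h.1).1.1)
      (fun U => Real.iSup_le (fun h => (hb 0 U h.1).1.2) (by positivity))
  have iCos : ∀ j, Integrable (supCosSq r S p j) (wilson4 r β S) := fun j =>
    hInt _ (hmcos j) (fun U => Real.iSup_nonneg fun h => froSq_nonneg _)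
      (fun U => Real.iSup_le (fun h => (hb j U h.1).2.1) (by positivity))
  have iSin : ∀ j, Integrable (supSinSq r S p j) (wilson4 r β S) := fun j =>
    hInt _ (hmsin j) (fun U => Real.iSup_nonneg fun h => froSq_nonneg _)
      (fun U => Real.iSup_le (fun h => (hb j U h.1).2.2) (by positivity))
  refine ⟨?_, ?_, ?_⟩
  · -- (A) pointwise `sup cov ≤ L⁻³ Σ_j (sup ‖Ĉ_j‖² + sup ‖Ŝ_j‖²)`, then integrate
    have hpt : ∀ U, supCov r S p U ≤
        (1 / (2 * S + 1 : ℝ) ^ 3) * ∑ j : Fin 3, (supCosSq r S p j U + supSinSq r S p j U) := by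
      intro U
      haveI := hne U
      refine ciSup_le fun h => ?_
      rw [modeCov_eq_cos_sin, div_eq_mul_one_div, mul_comm]
      refine mul_le_mul_of_nonneg_left (Finset.sum_le_sum fun j _ => add_le_add ?_ ?_)
        (by positivity)
      · exact le_ciSup (f := fun h' : {h // IsCoulMin r S U h} => froSq (cosMode r S p j U h'.1))
          ⟨_, by rintro _ ⟨h', rfl⟩; exact (hb j U h'.1).2.1⟩ h
      · exact le_ciSup (f := fun h' : {h // IsCoulMin r S U h} => froSq (sinMode r S p j U h'.1))
          ⟨_, by rintro _ ⟨h', rfl⟩; exact (hb j U h'.1).2.2⟩ h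
    calc ∫ U, supCov r S p U ∂(wilson4 r β S)
        ≤ ∫ U, (1 / (2 * S + 1 : ℝ) ^ 3) *
            ∑ j : Fin 3, (supCosSq r S p j U + supSinSq r S p j U) ∂(wilson4 r β S) :=
          integral_mono iCov
            ((integrable_finsetSum _ fun j _ => (iCos j).fun_add (iSin j)).const_mul _) hpt
      _ = _ := by
          rw [integral_const_mul, integral_finsetSum _ fun j _ => (iCos j).fun_add (iSin j)]
          congr 1
          exact Finset.sum_congr rfl fun j _ => integral_add (iCos j) (iSin j)
  · -- (B) the sine modes vanish at `p = 0`
    rintro rfl j U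
    have h0 : froSq (0 : Matrix (Fin r.N) (Fin r.N) ℂ) = 0 := by simp [froSq]
    simp only [supSinSq, sinMode_zero, h0]
    exact Real.iSup_const_zero
  · -- (C) components of the cosine mode in a measurable minimiser selection
    intro j sel hsel _hmin hsup
    haveI : SecondCountableTopology G :=
      (r.continuous.isClosedEmbedding r.injective).isEmbedding.secondCountableTopology
    have hV : ∀ e : Edge 4 (2 * S + 1),
        Measurable fun U : GaugeConfig 4 (2 * S + 1) G => gaugeTransform (sel U) U e := fun e => by
      simp only [gaugeTransform]
      exact (((measurable_pi_apply _).comp hsel).mul (measurable_pi_apply e)).mul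
        ((measurable_pi_apply _).comp hsel).inv
    have hgl : ∀ (y : Fin 3 → ZMod (2 * S + 1)) (a b : Fin r.N),
        Measurable fun U => gluon r S U (sel U) y j a b := fun y a b => by
      simp only [gluon, Matrix.smul_apply, Matrix.sub_apply, Matrix.conjTranspose_apply,
        smul_eq_mul]
      exact (((r.continuous.matrix_elem a b).measurable.comp (hV _)).sub
        (continuous_star.measurable.comp
          ((r.continuous.matrix_elem b a).measurable.comp (hV _)))).const_mul _
    have hCm : ∀ a b : Fin r.N, Measurable fun U => cosMode r S p j U (sel U) a b := fun a b => by
      simp only [cosMode, Matrix.sum_apply, Matrix.smul_apply, smul_eq_mul]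
      exact Finset.measurable_sum _ fun y _ => (hgl y a b).const_mul _
    have hcomp : ∀ (a b : Fin r.N) (q : Bool), Measurable (cosComp r S p j a b q sel) := by
      intro a b q
      cases q
      · exact Complex.measurable_im.comp (hCm a b)
      · exact Complex.measurable_re.comp (hCm a b)
    have hdom : ∀ (a b : Fin r.N) (q : Bool) (U : GaugeConfig 4 (2 * S + 1) G),
        (cosComp r S p j a b q sel U) ^ 2 ≤ (2 * S + 1 : ℝ) ^ 3 * modeCov r S U (sel U) p := by
      intro a b q U
      have h1 : (cosComp r S p j a b q sel U) ^ 2 ≤ ‖cosMode r S p j U (sel U) a b‖ ^ 2 := by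
        rw [Complex.sq_norm, Complex.normSq_apply]
        cases q <;> simp only [cosComp, cond_true, cond_false] <;>
          nlinarith [mul_self_nonneg (cosMode r S p j U (sel U) a b).re,
            mul_self_nonneg (cosMode r S p j U (sel U) a b).im]
      have h2 : ‖cosMode r S p j U (sel U) a b‖ ^ 2 ≤ froSq (cosMode r S p j U (sel U)) :=
        (Finset.single_le_sum (f := fun b' => ‖cosMode r S p j U (sel U) a b'‖ ^ 2)
          (fun _ _ => by positivity) (Finset.mem_univ b)).trans
        (Finset.single_le_sum (f := fun a' => ∑ b', ‖cosMode r S p j U (sel U) a' b'‖ ^ 2)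
          (fun _ _ => Finset.sum_nonneg fun _ _ => by positivity) (Finset.mem_univ a))
      have h3 : froSq (cosMode r S p j U (sel U)) ≤
          (2 * S + 1 : ℝ) ^ 3 * modeCov r S U (sel U) p := by
        rw [modeCov_eq_cos_sin, mul_div_cancel₀ _ hL.ne']
        exact (le_add_of_nonneg_right (froSq_nonneg _)).trans
          (Finset.single_le_sum (f := fun j' => froSq (cosMode r S p j' U (sel U)) +
            froSq (sinMode r S p j' U (sel U)))
            (fun _ _ => add_nonneg (froSq_nonneg _) (froSq_nonneg _)) (Finset.mem_univ j))
      exact h1.trans (h2.trans h3)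
    have hint : ∀ (a b : Fin r.N) (q : Bool),
        Integrable (fun U => (cosComp r S p j a b q sel U) ^ 2) (wilson4 r β S) := fun a b q =>
      hInt _ ((hcomp a b q).pow_const 2) (fun U => sq_nonneg _) fun U =>
        (hdom a b q U).trans (mul_le_mul_of_nonneg_left (hb j U (sel U)).1.2 hL.le)
    refine ⟨?_, hcomp, hdom⟩
    have hptw : ∀ U,
        supCosSq r S p j U = ∑ a, ∑ b, ∑ q : Bool, (cosComp r S p j a b q sel U) ^ 2 := fun U => by
      rw [← hsup U, froSq]
      refine Finset.sum_congr rfl fun a _ => Finset.sum_congr rfl fun b _ => ?_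
      rw [Fintype.sum_bool, Complex.sq_norm, Complex.normSq_apply]
      simp only [cosComp, cond_true, cond_false]
      ring
    simp_rw [hptw]
    rw [integral_finsetSum _ fun a _ =>
      integrable_finsetSum _ fun b _ => integrable_finsetSum _ fun q _ => hint a b q]
    refine Finset.sum_congr rfl fun a _ => ?_
    rw [integral_finsetSum _ fun b _ => integrable_finsetSum _ fun q _ => hint a b q]
    exact Finset.sum_congr rfl fun b _ => integral_finsetSum _ fun q _ => hint a b q

end Summit.QuantumFields.YangMills.Cruxes.CovarianceBound.SupportWindow

end
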